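import Summits.QuantumFields.BalabanUV.Beta.GAN24.CapacitanceScalarBounds

/-!
# `BalabanUV.Beta.GAN24.CapacitanceScalarBoundsBorder` — binder row G-an2-4 / (CONV-C), road P1-fibre: TWO-SIDED `N`-UNIFORM BOUNDS
# for the BORDER scalar `σ(p)` and the SCHUR scalar `h(p)` of the capacitance matrix at real momentum (companion of
# `GAN24/CapacitanceScalarBounds`, same leaf; nodes N09/N10 of SKELETON-P1)

NOT IN PRINT; OUR PROOF ATTEMPT.  HONEST FRAMING (cell contract, verbatim): «discharging `BetaPertH` makes Bałaban's UV stability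
UNCONDITIONAL — a real constructive-QFT result; it is NOT the continuum limit and NOT the Clay problem.»  HONEST DEPENDENCY (verbatim):
«continuum YM on T⁴ ⇐ BetaPertH ∧ nine spine estimates (0/9 proved); BetaPertH ⇐ (D1) ∧ (D4) ∧ CAP+tail; G-an2-4 gates asym, D1 and
NE2/3/4.»  [folklore] explicit analysis (King 1986 Lemma 4.1 pattern); it discharges NOTHING of (CONV-C)'s K-slot
`GAN24.CombesThomas.ConvCK 3 Lc` by itself.  NOT `BetaPertH`, NOT continuum, NOT Clay.  No `def … : Prop`, no cited fact, no wall binder.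

## The objects (see `GAN24/CapacitanceScalarBounds` for `gNormSq`, `blockWt`, `capDiag = a_κ` and the zero-alias lemmas)
* `capBorder N p = σ(p) = Σ_{m ∈ (ℤ/N)^D} w_m/L_m²` (= `Σ_m wM_m wG_m/L_m²` at real `p`),
* `capH N p = h(p) = Σ_κ 4 sin²(p_κ/2)/a_κ(p)` (= `Σ_κ δ_κ δ♭_κ/a_κ`, `δ = dhat p` the COARSE symbol, at real `p`).

## What is proved (every `D`, every `N ≥ 1`, every `p ∈ [−π, π]^D` with `p ≠ 0`, `|p|² = momSq p`; constants explicit and symbolic in `D`)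
* §4 **`capBorder_ge`**: `(4/π²)^D·N^{D+4}/|p|⁴ ≤ σ(p)`;  **`capBorder_le`**: `σ(p) ≤ N^{D+4}·(π⁴/(16|p|⁴) + aliasWtConst D/4)`;
  `capBorder_pos`, `inv_capBorder_le` (`σ⁻¹ ≤ |p|⁴/((4/π²)^D N^{D+4})`);
* §5 `four_sin_sq_sum_bounds` (`(4/π²)|p|² ≤ Σ_κ 4 sin²(p_κ/2) ≤ |p|²`), **`capH_ge`** / **`capH_le`**:
  `(4/π²)|p|²/(N^{D+4}(π²/(8|p|²) + aliasWtConst D/2)) ≤ h(p) ≤ 2(π²/4)^{D+1}|p|⁴/N^{D+4}`; `capH_pos`, `inv_capH_le`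
  (the hypotheses `‖σ⁻¹‖ ≤ ς`, `‖h⁻¹‖ ≤ η` of `CapacitanceClosedForm` §6, with `N`-free constants × the `p`-scalings).

Unit `b2b-balaban-gan24-formalise-leaf-12` (G-an2-4 formalisation swarm, leaf prover 12), 2026-08-19.  Value = kernel estimate leaf toward
the K-slot route P1, NOT summit progress.
-/

noncomputable section

open Complex Finset
open scoped BigOperators Real

namespace Summit.QuantumFields.BalabanUV.Beta.GAN24.CapacitanceScalarBoundsBorder

open AliasWeights AliasWeightsSum CapacitanceScalarBounds
open Literature.MathematicalPhysics.QuantumFieldTheory.King1986 (momSq momSq_nonneg)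

variable {D : ℕ}
/-! ## §4  The border scalar `σ(p)` -/

/-- The BORDER capacitance scalar `σ(p) = Σ_{m ∈ (ℤ/N)^D} w_m/L_m²` (`= Σ_m wM_m wG_m/L_m²` at real `p`). -/
def capBorder (N : ℕ) [NeZero N] (p : Fin D → ℝ) : ℝ :=
  ∑ m : Fin D → ZMod N, blockWt N p m / lapR (kfine N p m) ^ 2

/-- [folklore] Every summand of `σ` is `≥ 0`. -/
theorem capBorder_term_nonneg (N : ℕ) [NeZero N] (p : Fin D → ℝ) (m : Fin D → ZMod N) :
    0 ≤ blockWt N p m / lapR (kfine N p m) ^ 2 :=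
  div_nonneg (blockWt_nonneg _ _ _) (sq_nonneg _)

/-- **LOWER BOUND FOR `σ` (zero alias alone).**  For `N ≥ 1`, `p ∈ [−π, π]^D`, `p ≠ 0`:
`(4/π²)^D · N^{D+4}/|p|⁴ ≤ σ(p)`. [folklore; King 1986 Lemma 4.1 pattern] -/
theorem capBorder_ge {N : ℕ} [NeZero N] (hN : 1 ≤ N) {p : Fin D → ℝ} (hp : ∀ i, |p i| ≤ π) (hp0 : p ≠ 0) :
    (4 / π ^ 2) ^ D * (N : ℝ) ^ (D + 4) / momSq p ^ 2 ≤ capBorder N p := by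
  have hN0 : (0 : ℝ) < N := by exact_mod_cast hN
  have hL0 := lapR_zero_pos hN hp hp0
  have hm := momSq_pos hp0
  have hLup : lapR (kfine N p 0) ^ 2 ≤ (momSq p / (N : ℝ) ^ 2) ^ 2 := by
    have := sq_mul_lapR_zero_le hN p
    refine pow_le_pow_left₀ hL0.le ?_ 2
    rw [le_div_iff₀ (by positivity)]
    linarith
  have hπ0 : (0 : ℝ) < π := Real.pi_pos
  have h0 : (4 / π ^ 2) ^ D * (N : ℝ) ^ (D + 4) / momSq p ^ 2 ≤ blockWt N p 0 / lapR (kfine N p 0) ^ 2 :=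
    calc (4 / π ^ 2) ^ D * (N : ℝ) ^ (D + 4) / momSq p ^ 2
        = (4 / π ^ 2) ^ D * (N : ℝ) ^ D / (momSq p / (N : ℝ) ^ 2) ^ 2 := by
          rw [pow_add]
          field_simp
      _ ≤ (4 / π ^ 2) ^ D * (N : ℝ) ^ D / lapR (kfine N p 0) ^ 2 :=
          div_le_div_of_nonneg_left (by positivity) (by positivity) hLup
      _ ≤ blockWt N p 0 / lapR (kfine N p 0) ^ 2 :=
          div_le_div_of_nonneg_right (pow_le_blockWt_zero hN hp) (sq_nonneg _)
  unfold capBorder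
  exact h0.trans (Finset.single_le_sum (f := fun m => blockWt N p m / lapR (kfine N p m) ^ 2)
    (fun m _ => capBorder_term_nonneg N p m) (Finset.mem_univ _))

/-- [folklore] A NONZERO-ALIAS TERM OF `σ` FROM ABOVE: `w_m/L_m² ≤ (N^{D+4}/4)·aliasWtTerm N p m` (`4 ≤ N²L_m`). -/
theorem capBorder_term_le {N : ℕ} [NeZero N] (hN : 1 ≤ N) {p : Fin D → ℝ} (hp : ∀ i, |p i| ≤ π)
    {m : Fin D → ZMod N} (hm : m ≠ 0) :
    blockWt N p m / lapR (kfine N p m) ^ 2 ≤ (N : ℝ) ^ (D + 4) / 4 * aliasWtTerm N p m := by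
  have hN0 : (0 : ℝ) < N := by exact_mod_cast hN
  have hL := lapR_pos_of_ne_zero hp hm
  have h4 := four_le_sq_mul_lapR hp hm
  have hP0 : 0 ≤ ∏ i, sinWt N (kfine N p m i) := Finset.prod_nonneg fun i _ => (sinWt_pos _ _).le
  set L := lapR (kfine N p m) with hLdef
  set P := ∏ i, sinWt N (kfine N p m i) with hPdef
  -- w_m/L² ≤ N^D P/L² = N^{D+4}·(P/(N²L))·(1/(N²L)) ≤ N^{D+4}·(P/(N²L))/4
  have h1 : blockWt N p m / L ^ 2 ≤ (N : ℝ) ^ D * P / L ^ 2 :=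
    div_le_div_of_nonneg_right (blockWt_le hN p m) (sq_nonneg _)
  have h2 : (N : ℝ) ^ D * P / L ^ 2 = (N : ℝ) ^ (D + 4) * (P / ((N : ℝ) ^ 2 * L)) * (1 / ((N : ℝ) ^ 2 * L)) := by
    field_simp; ring
  have h3 : 1 / ((N : ℝ) ^ 2 * L) ≤ 1 / 4 := div_le_div_of_nonneg_left zero_le_one (by norm_num) h4
  have hQ0 : 0 ≤ (N : ℝ) ^ (D + 4) * (P / ((N : ℝ) ^ 2 * L)) := by positivity
  calc blockWt N p m / L ^ 2 ≤ (N : ℝ) ^ D * P / L ^ 2 := h1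
    _ = (N : ℝ) ^ (D + 4) * (P / ((N : ℝ) ^ 2 * L)) * (1 / ((N : ℝ) ^ 2 * L)) := h2
    _ ≤ (N : ℝ) ^ (D + 4) * (P / ((N : ℝ) ^ 2 * L)) * (1 / 4) := mul_le_mul_of_nonneg_left h3 hQ0
    _ = (N : ℝ) ^ (D + 4) / 4 * aliasWtTerm N p m := by
        rw [hPdef, hLdef]; unfold aliasWtTerm; ring

/-- **UPPER BOUND FOR `σ`.**  For `N ≥ 1`, `p ∈ [−π, π]^D`, `p ≠ 0`:
`σ(p) ≤ N^{D+4} · (π⁴/(16|p|⁴) + aliasWtConst D/4)`. [folklore] -/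
theorem capBorder_le {N : ℕ} [NeZero N] (hN : 1 ≤ N) {p : Fin D → ℝ} (hp : ∀ i, |p i| ≤ π) (hp0 : p ≠ 0) :
    capBorder N p ≤ (N : ℝ) ^ (D + 4) * (π ^ 4 / (16 * momSq p ^ 2) + aliasWtConst D / 4) := by
  classical
  have hN0 : (0 : ℝ) < N := by exact_mod_cast hN
  have hm := momSq_pos hp0
  have hπ0 : (0 : ℝ) < π := Real.pi_pos
  -- zero alias: w_0 ≤ N^D, L_0 ≥ (4/π²)|p|²/N²
  have hLlow : (4 / π ^ 2 * momSq p / (N : ℝ) ^ 2) ^ 2 ≤ lapR (kfine N p 0) ^ 2 := by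
    have := le_sq_mul_lapR_zero hN hp
    refine pow_le_pow_left₀ (by positivity) ?_ 2
    rw [div_le_iff₀ (by positivity)]
    linarith
  have h0 : blockWt N p 0 / lapR (kfine N p 0) ^ 2 ≤ π ^ 4 * (N : ℝ) ^ (D + 4) / (16 * momSq p ^ 2) :=
    calc blockWt N p 0 / lapR (kfine N p 0) ^ 2 ≤ (N : ℝ) ^ D / lapR (kfine N p 0) ^ 2 :=
          div_le_div_of_nonneg_right (blockWt_le_pow hN p 0) (sq_nonneg _)
      _ ≤ (N : ℝ) ^ D / (4 / π ^ 2 * momSq p / (N : ℝ) ^ 2) ^ 2 :=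
          div_le_div_of_nonneg_left (by positivity) (by positivity) hLlow
      _ = π ^ 4 * (N : ℝ) ^ (D + 4) / (16 * momSq p ^ 2) := by
          rw [pow_add]
          field_simp
          ring
  have hrest : ∑ m ∈ (Finset.univ : Finset (Fin D → ZMod N)).erase 0, blockWt N p m / lapR (kfine N p m) ^ 2
      ≤ (N : ℝ) ^ (D + 4) / 4 * aliasWtConst D := by
    calc ∑ m ∈ (Finset.univ : Finset (Fin D → ZMod N)).erase 0, blockWt N p m / lapR (kfine N p m) ^ 2
        ≤ ∑ m ∈ (Finset.univ : Finset (Fin D → ZMod N)).erase 0, (N : ℝ) ^ (D + 4) / 4 * aliasWtTerm N p m :=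
          Finset.sum_le_sum fun m hm => capBorder_term_le hN hp (Finset.ne_of_mem_erase hm)
      _ = (N : ℝ) ^ (D + 4) / 4 * ∑ m ∈ (Finset.univ : Finset (Fin D → ZMod N)).erase 0, aliasWtTerm N p m := by
          rw [Finset.mul_sum]
      _ ≤ (N : ℝ) ^ (D + 4) / 4 * aliasWtConst D :=
          mul_le_mul_of_nonneg_left (alias_sum_le N hp) (by positivity)
  unfold capBorder
  rw [← Finset.add_sum_erase _ _ (Finset.mem_univ (0 : Fin D → ZMod N))]
  calc blockWt N p 0 / lapR (kfine N p 0) ^ 2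
        + ∑ m ∈ (Finset.univ : Finset (Fin D → ZMod N)).erase 0, blockWt N p m / lapR (kfine N p m) ^ 2
      ≤ π ^ 4 * (N : ℝ) ^ (D + 4) / (16 * momSq p ^ 2) + (N : ℝ) ^ (D + 4) / 4 * aliasWtConst D := add_le_add h0 hrest
    _ = (N : ℝ) ^ (D + 4) * (π ^ 4 / (16 * momSq p ^ 2) + aliasWtConst D / 4) := by ring

/-- [folklore] `0 < σ(p)` on the punctured zone, every `N ≥ 1`. -/
theorem capBorder_pos {N : ℕ} [NeZero N] (hN : 1 ≤ N) {p : Fin D → ℝ} (hp : ∀ i, |p i| ≤ π) (hp0 : p ≠ 0) :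
    0 < capBorder N p := by
  have hN0 : (0 : ℝ) < N := by exact_mod_cast hN
  have hm := momSq_pos hp0
  exact lt_of_lt_of_le (by positivity) (capBorder_ge hN hp hp0)

/-- [folklore] INVERSE FORM (the hypothesis `‖σ⁻¹‖ ≤ ς` of `CapacitanceClosedForm` §6): `σ(p)⁻¹ ≤ |p|⁴/((4/π²)^D N^{D+4})`. -/
theorem inv_capBorder_le {N : ℕ} [NeZero N] (hN : 1 ≤ N) {p : Fin D → ℝ} (hp : ∀ i, |p i| ≤ π) (hp0 : p ≠ 0) :
    (capBorder N p)⁻¹ ≤ momSq p ^ 2 / ((4 / π ^ 2) ^ D * (N : ℝ) ^ (D + 4)) := by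
  have hN0 : (0 : ℝ) < N := by exact_mod_cast hN
  have hm := momSq_pos hp0
  have hlow : 0 < (4 / π ^ 2) ^ D * (N : ℝ) ^ (D + 4) / momSq p ^ 2 := by positivity
  calc (capBorder N p)⁻¹ ≤ ((4 / π ^ 2) ^ D * (N : ℝ) ^ (D + 4) / momSq p ^ 2)⁻¹ :=
        inv_anti₀ hlow (capBorder_ge hN hp hp0)
    _ = momSq p ^ 2 / ((4 / π ^ 2) ^ D * (N : ℝ) ^ (D + 4)) := by rw [inv_div]

/-! ## §5  The Schur scalar `h(p) = Σ_κ δ_κδ♭_κ/a_κ` -/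

/-- The SCHUR scalar `h(p) = Σ_κ 4 sin²(p_κ/2)/a_κ(p)` (`= Σ_κ δ_κ δ♭_κ/a_κ`, `δ = dhat p` the COARSE symbol, at real `p`). -/
def capH (N : ℕ) [NeZero N] (p : Fin D → ℝ) : ℝ := ∑ κ, 4 * Real.sin (p κ / 2) ^ 2 / capDiag N p κ

/-- [folklore] Two-sided coarse symbol: `(4/π²)|p|² ≤ Σ_κ 4 sin²(p_κ/2) ≤ |p|²` on `[−π, π]^D`. -/
theorem four_sin_sq_sum_bounds {p : Fin D → ℝ} (hp : ∀ i, |p i| ≤ π) :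
    4 / π ^ 2 * momSq p ≤ ∑ κ, 4 * Real.sin (p κ / 2) ^ 2 ∧ ∑ κ, 4 * Real.sin (p κ / 2) ^ 2 ≤ momSq p := by
  unfold momSq
  constructor
  · rw [Finset.mul_sum]
    exact Finset.sum_le_sum fun κ _ => SymbolTaylor.jordan_four_sin_sq_half (hp κ)
  · refine Finset.sum_le_sum fun κ _ => ?_
    have h := Real.sin_sq_le_sq (x := p κ / 2)
    nlinarith

/-- **LOWER BOUND FOR `h`.**  For `N ≥ 1`, `p ∈ [−π, π]^D`, `p ≠ 0`:
`(4/π²)|p|² / (N^{D+4}(π²/(8|p|²) + aliasWtConst D/2)) ≤ h(p)` (i.e. `h ≳ |p|⁴/N^{D+4}`). [folklore] -/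
theorem capH_ge {N : ℕ} [NeZero N] (hN : 1 ≤ N) {p : Fin D → ℝ} (hp : ∀ i, |p i| ≤ π) (hp0 : p ≠ 0) :
    4 / π ^ 2 * momSq p / ((N : ℝ) ^ (D + 4) * (π ^ 2 / (8 * momSq p) + aliasWtConst D / 2)) ≤ capH N p := by
  have hN0 : (0 : ℝ) < N := by exact_mod_cast hN
  have hm := momSq_pos hp0
  set U := (N : ℝ) ^ (D + 4) * (π ^ 2 / (8 * momSq p) + aliasWtConst D / 2) with hU
  have hC : 0 ≤ aliasWtConst D := by
    unfold aliasWtConst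
    have : (1 : ℝ) ≤ (5 : ℝ) ^ D := one_le_pow₀ (by norm_num)
    exact div_nonneg (by linarith) (by norm_num)
  have hU0 : 0 < U := by rw [hU]; positivity
  unfold capH
  calc 4 / π ^ 2 * momSq p / U ≤ (∑ κ, 4 * Real.sin (p κ / 2) ^ 2) / U :=
        div_le_div_of_nonneg_right (four_sin_sq_sum_bounds hp).1 hU0.le
    _ = ∑ κ, 4 * Real.sin (p κ / 2) ^ 2 / U := by rw [Finset.sum_div]
    _ ≤ ∑ κ, 4 * Real.sin (p κ / 2) ^ 2 / capDiag N p κ :=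
        Finset.sum_le_sum fun κ _ =>
          div_le_div_of_nonneg_left (by positivity) (capDiag_pos hN hp hp0 κ) (capDiag_le hN hp hp0 κ)

/-- **UPPER BOUND FOR `h`.**  For `N ≥ 1`, `p ∈ [−π, π]^D`, `p ≠ 0`:  `h(p) ≤ 2(π²/4)^{D+1}·|p|⁴/N^{D+4}`. [folklore] -/
theorem capH_le {N : ℕ} [NeZero N] (hN : 1 ≤ N) {p : Fin D → ℝ} (hp : ∀ i, |p i| ≤ π) (hp0 : p ≠ 0) :
    capH N p ≤ 2 * (π ^ 2 / 4) ^ (D + 1) * momSq p ^ 2 / (N : ℝ) ^ (D + 4) := by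
  have hN0 : (0 : ℝ) < N := by exact_mod_cast hN
  have hm := momSq_pos hp0
  have hπ : 0 < π ^ 2 / 4 := by positivity
  set Lo := (4 / π ^ 2) ^ (D + 1) * (N : ℝ) ^ (D + 4) / (2 * momSq p) with hLo
  have hLo0 : 0 < Lo := by rw [hLo]; positivity
  unfold capH
  calc ∑ κ, 4 * Real.sin (p κ / 2) ^ 2 / capDiag N p κ ≤ ∑ κ, 4 * Real.sin (p κ / 2) ^ 2 / Lo :=
        Finset.sum_le_sum fun κ _ => div_le_div_of_nonneg_left (by positivity) hLo0 (capDiag_ge hN hp hp0 κ)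
    _ = (∑ κ, 4 * Real.sin (p κ / 2) ^ 2) / Lo := by rw [Finset.sum_div]
    _ ≤ momSq p / Lo := div_le_div_of_nonneg_right (four_sin_sq_sum_bounds hp).2 hLo0.le
    _ = 2 * (π ^ 2 / 4) ^ (D + 1) * momSq p ^ 2 / (N : ℝ) ^ (D + 4) := by
        have hπ0 : (0 : ℝ) < π := Real.pi_pos
        rw [hLo, div_div_eq_mul_div, show (4 / π ^ 2 : ℝ) = (π ^ 2 / 4)⁻¹ by rw [inv_div], inv_pow]
        have hc : (0 : ℝ) < (π ^ 2 / 4) ^ (D + 1) := by positivity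
        field_simp

/-- [folklore] `0 < h(p)` on the punctured zone, every `N ≥ 1`. -/
theorem capH_pos {N : ℕ} [NeZero N] (hN : 1 ≤ N) {p : Fin D → ℝ} (hp : ∀ i, |p i| ≤ π) (hp0 : p ≠ 0) :
    0 < capH N p := by
  have hN0 : (0 : ℝ) < N := by exact_mod_cast hN
  have hm := momSq_pos hp0
  have hC : 0 ≤ aliasWtConst D := by
    unfold aliasWtConst
    have : (1 : ℝ) ≤ (5 : ℝ) ^ D := one_le_pow₀ (by norm_num)
    exact div_nonneg (by linarith) (by norm_num)
  exact lt_of_lt_of_le (by positivity) (capH_ge hN hp hp0)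

/-- [folklore] INVERSE FORM (the hypothesis `‖h⁻¹‖ ≤ η` of `CapacitanceClosedForm` §6):
`h(p)⁻¹ ≤ N^{D+4}(π²/(8|p|²) + aliasWtConst D/2) / ((4/π²)|p|²)` (i.e. `h⁻¹ ≲ N^{D+4}/|p|⁴`). -/
theorem inv_capH_le {N : ℕ} [NeZero N] (hN : 1 ≤ N) {p : Fin D → ℝ} (hp : ∀ i, |p i| ≤ π) (hp0 : p ≠ 0) :
    (capH N p)⁻¹ ≤ (N : ℝ) ^ (D + 4) * (π ^ 2 / (8 * momSq p) + aliasWtConst D / 2) / (4 / π ^ 2 * momSq p) := by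
  have hN0 : (0 : ℝ) < N := by exact_mod_cast hN
  have hm := momSq_pos hp0
  have hC : 0 ≤ aliasWtConst D := by
    unfold aliasWtConst
    have : (1 : ℝ) ≤ (5 : ℝ) ^ D := one_le_pow₀ (by norm_num)
    exact div_nonneg (by linarith) (by norm_num)
  have hlow : 0 < 4 / π ^ 2 * momSq p / ((N : ℝ) ^ (D + 4) * (π ^ 2 / (8 * momSq p) + aliasWtConst D / 2)) := by
    positivity
  calc (capH N p)⁻¹ ≤ (4 / π ^ 2 * momSq p / ((N : ℝ) ^ (D + 4) * (π ^ 2 / (8 * momSq p) + aliasWtConst D / 2)))⁻¹ :=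
        inv_anti₀ hlow (capH_ge hN hp hp0)
    _ = (N : ℝ) ^ (D + 4) * (π ^ 2 / (8 * momSq p) + aliasWtConst D / 2) / (4 / π ^ 2 * momSq p) := by
        rw [inv_div]

end Summit.QuantumFields.BalabanUV.Beta.GAN24.CapacitanceScalarBoundsBorder

end
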